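import Mathlib
import Summits.Ventures.PercRepro2.Defs
import Summits.Ventures.PercRepro2.Graph
import Summits.Ventures.PercRepro2.OneColourSwitch
import Summits.Ventures.PercRepro2.RegionHubSign
import Summits.Ventures.PercRepro2.SideSwitch
import Summits.Ventures.PercRepro2.M9NoPocketDefs
import Summits.Ventures.PercRepro2.M9PocketRSEdgeTransfer
import Summits.Ventures.PercRepro2.M9PocketRootOnlyTransfer

/-!
# A cluster hanging from `{r, s, d}` — paths through three exits (blind cell PercRepro2,
p3 g42, 2026-08-30; `proofs/P3-POCKETRK.md` §10⁶ (a): the transfer half of the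
`{r, s, d}`-cluster type calculus)

Let `L` be a vertex set with `p, q, r, s, d ∉ L` every edge of which has its other endpoint in
`L ∪ {r, s, d}` (a linking free block together with the pocket vertices it is attached to, when
it touches nothing on the `p, q` side), and `F` the edges inside `L ∪ {r, s, d}`.  A path of `G`
alternates between segments of the restriction `G − F` and of the `F`-graph, changing graph
only at the three EXITS `r`, `s`, `d`.  Hence: a path from an exit ends with a segment from an
exit reached from the first one (`exists_exit_of_conn_rsd`), with the last segment in `G − F`
for a target off `L` and in the `F`-graph for a target in `L` (`exists_exit_restrict_of_conn_rsd`,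
`exists_exit_F_of_conn_rsd`); `d` is reached from `r` or `s` iff it is reached by a segment of
one of the two graphs from `r` or `s` — the first visit (`d_mem_K2_iff_rsd`).  The link
`r ~ s` is in `M9PocketRSDJoin`.  The colour flip commutes with both restrictions, so every
statement holds for the `W`-colour as well.  Own work; std axioms.
-/

namespace Summit.Ventures.PercRepro2

namespace NoPocket

open Finset Classical OneColourSwitch SideSwitch

variable {V : Type*} {E : Type*} {ends : E → Sym2 V} {p q r s d : V} {ω : Config E} {L : Set V}

section ClusterRSD

/-- An edge at a vertex of `L` lies inside `L ∪ {r, s, d}`. -/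
lemma mem_within_of_mem_L_rsd
    (hL : ∀ e x y, ends e = s(x, y) → x ∈ L → y ∈ L ∨ y = r ∨ y = s ∨ y = d)
    {e : E} {a b : V} (hab : ends e = s(a, b)) (ha : a ∈ L) :
    e ∈ within ends (L ∪ {r, s, d} : Set V) := by
  refine ⟨a, Or.inl ha, b, ?_, hab⟩
  rcases hL e a b hab ha with h | h | h | h
  · exact Or.inl h
  · exact Or.inr (by rw [h]; simp)
  · exact Or.inr (by rw [h]; simp)
  · exact Or.inr (by rw [h]; simp)

/-- An edge off `F` has no endpoint in `L`. -/
lemma notMem_L_of_notMem_within_rsd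
    (hL : ∀ e x y, ends e = s(x, y) → x ∈ L → y ∈ L ∨ y = r ∨ y = s ∨ y = d)
    {e : E} (he : e ∉ within ends (L ∪ {r, s, d} : Set V)) {a b : V} (hab : ends e = s(a, b)) :
    a ∉ L ∧ b ∉ L := by
  constructor
  · intro ha
    exact he (mem_within_of_mem_L_rsd hL hab ha)
  · intro hb
    exact he (mem_within_of_mem_L_rsd hL (by rw [hab, Sym2.eq_swap]) hb)

/-- A restricted path (edges off `F`) from a vertex off `L` never enters `L`. -/
lemma notMem_L_of_conn_restrict_rsd
    (hL : ∀ e x y, ends e = s(x, y) → x ∈ L → y ∈ L ∨ y = r ∨ y = s ∨ y = d) {x y : V}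
    (hx : x ∉ L)
    (h : Conn (fun e : {e // e ∉ within ends (L ∪ {r, s, d} : Set V)} => ends e.1)
      (fun e => ω e.1) x y) : y ∉ L := by
  have key : y ∈ {z | z ∉ L} := by
    refine mem_of_conn_of_closed (S := {z | z ∉ L}) ?_ hx h
    intro a _ b hab
    obtain ⟨_, e, _, hends⟩ := openGraph_adj.1 hab
    exact (notMem_L_of_notMem_within_rsd hL e.2 hends).2
  exact key

/-- A path of the `F`-graph from a vertex of `L ∪ {r, s, d}` stays in `L ∪ {r, s, d}`. -/
lemma mem_of_conn_F_rsd {x y : V} (hx : x ∈ (L ∪ {r, s, d} : Set V))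
    (h : Conn (fun e : {e // ¬ (e ∉ within ends (L ∪ {r, s, d} : Set V))} => ends e.1)
      (fun e => ω e.1) x y) : y ∈ (L ∪ {r, s, d} : Set V) := by
  refine mem_of_conn_of_closed (S := (L ∪ {r, s, d} : Set V)) ?_ hx h
  intro a _ b hab
  obtain ⟨_, e, _, hends⟩ := openGraph_adj.1 hab
  exact (mem_of_mem_within (not_not.1 e.2) hends).2

/-- A vertex of `L ∪ {r, s, d}` off `L` is an exit. -/
lemma exit_of_mem_of_notMem {a : V} (ha : a ∈ (L ∪ {r, s, d} : Set V)) (haL : a ∉ L) :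
    a = r ∨ a = s ∨ a = d := by
  simp only [Set.mem_union, Set.mem_insert_iff, Set.mem_singleton_iff] at ha
  rcases ha with h | h
  · exact (haL h).elim
  · exact h

/-- **The last segment**: a `Y`-path of `G` from an exit `t` to `x` ends with a segment of
`G − F` or of the `F`-graph starting at an exit `t'` reached from `t`. -/
lemma exists_exit_of_conn_rsd
    (hL : ∀ e x y, ends e = s(x, y) → x ∈ L → y ∈ L ∨ y = r ∨ y = s ∨ y = d)
    (hr : r ∉ L) (hs : s ∉ L) (hd : d ∉ L) {t x : V} (ht : t = r ∨ t = s ∨ t = d)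
    (h : Conn ends ω t x) :
    ∃ t', (t' = r ∨ t' = s ∨ t' = d) ∧ Conn ends ω t t' ∧
      (Conn (fun e : {e // e ∉ within ends (L ∪ {r, s, d} : Set V)} => ends e.1) (fun e => ω e.1)
        t' x ∨
      Conn (fun e : {e // ¬ (e ∉ within ends (L ∪ {r, s, d} : Set V))} => ends e.1)
        (fun e => ω e.1) t' x) := by
  have htL : t ∉ L := by rcases ht with rfl | rfl | rfl <;> assumption
  refine mem_of_conn_of_closed (S := {z | ∃ t', (t' = r ∨ t' = s ∨ t' = d) ∧ Conn ends ω t t' ∧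
    (Conn (fun e : {e // e ∉ within ends (L ∪ {r, s, d} : Set V)} => ends e.1) (fun e => ω e.1)
        t' z ∨
      Conn (fun e : {e // ¬ (e ∉ within ends (L ∪ {r, s, d} : Set V))} => ends e.1)
        (fun e => ω e.1) t' z)}) ?_ ⟨t, ht, conn_refl _ _ _, Or.inl (conn_refl _ _ _)⟩ h
  rintro a ⟨t', ht', htt', ha⟩ b hab
  simp only [Set.mem_setOf_eq]
  obtain ⟨_, e, he, hends⟩ := openGraph_adj.1 hab
  have ht'L : t' ∉ L := by rcases ht' with rfl | rfl | rfl <;> assumption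
  by_cases hP : e ∈ within ends (L ∪ {r, s, d} : Set V)
  · -- an edge of the `F`-graph
    have hadj : Conn (fun e : {e // ¬ (e ∉ within ends (L ∪ {r, s, d} : Set V))} => ends e.1)
        (fun e => ω e.1) a b :=
      conn_of_openAdj ⟨⟨e, not_not.2 hP⟩, he, hends⟩
    rcases ha with ha | ha
    · -- `a` is on a restricted path from `t'`: `a` is an exit
      have haL : a ∉ L := notMem_L_of_conn_restrict_rsd hL ht'L ha
      have haE : a = r ∨ a = s ∨ a = d :=
        exit_of_mem_of_notMem (mem_of_mem_within hP hends).1 haL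
      exact ⟨a, haE, conn_trans htt' (conn_of_conn_restrict ha), Or.inr hadj⟩
    · exact ⟨t', ht', htt', Or.inr (conn_trans ha hadj)⟩
  · -- an edge off `F`
    have hadj : Conn (fun e : {e // e ∉ within ends (L ∪ {r, s, d} : Set V)} => ends e.1)
        (fun e => ω e.1) a b :=
      conn_of_openAdj ⟨⟨e, hP⟩, he, hends⟩
    have haL : a ∉ L := (notMem_L_of_notMem_within_rsd hL hP hends).1
    rcases ha with ha | ha
    · exact ⟨t', ht', htt', Or.inl (conn_trans ha hadj)⟩
    · -- `a` is on an `F`-path from `t'`: `a ∈ L ∪ {r, s, d}`, not in `L`, an exit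
      have haE : a = r ∨ a = s ∨ a = d :=
        exit_of_mem_of_notMem (mem_of_conn_F_rsd (by rcases ht' with rfl | rfl | rfl <;> simp) ha)
          haL
      exact ⟨a, haE, conn_trans htt' (conn_of_conn_restrict ha), Or.inl hadj⟩

/-- **The last segment, target off `L`**: it is a segment of `G − F`. -/
lemma exists_exit_restrict_of_conn_rsd
    (hL : ∀ e x y, ends e = s(x, y) → x ∈ L → y ∈ L ∨ y = r ∨ y = s ∨ y = d)
    (hr : r ∉ L) (hs : s ∉ L) (hd : d ∉ L) {t x : V} (ht : t = r ∨ t = s ∨ t = d) (hx : x ∉ L)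
    (h : Conn ends ω t x) :
    ∃ t', (t' = r ∨ t' = s ∨ t' = d) ∧ Conn ends ω t t' ∧
      Conn (fun e : {e // e ∉ within ends (L ∪ {r, s, d} : Set V)} => ends e.1) (fun e => ω e.1)
        t' x := by
  obtain ⟨t', ht', htt', hc | hc⟩ := exists_exit_of_conn_rsd hL hr hs hd ht h
  · exact ⟨t', ht', htt', hc⟩
  · -- an `F`-path ends in `L ∪ {r, s, d}`; off `L` the target is an exit
    have hxE : x = r ∨ x = s ∨ x = d :=
      exit_of_mem_of_notMem (mem_of_conn_F_rsd (by rcases ht' with rfl | rfl | rfl <;> simp) hc) hx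
    exact ⟨x, hxE, conn_trans htt' (conn_of_conn_restrict hc), conn_refl _ _ _⟩

/-- **The last segment, target in `L`**: it is a segment of the `F`-graph. -/
lemma exists_exit_F_of_conn_rsd
    (hL : ∀ e x y, ends e = s(x, y) → x ∈ L → y ∈ L ∨ y = r ∨ y = s ∨ y = d)
    (hr : r ∉ L) (hs : s ∉ L) (hd : d ∉ L) {t x : V} (ht : t = r ∨ t = s ∨ t = d) (hx : x ∈ L)
    (h : Conn ends ω t x) :
    ∃ t', (t' = r ∨ t' = s ∨ t' = d) ∧ Conn ends ω t t' ∧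
      Conn (fun e : {e // ¬ (e ∉ within ends (L ∪ {r, s, d} : Set V))} => ends e.1)
        (fun e => ω e.1) t' x := by
  obtain ⟨t', ht', htt', hc | hc⟩ := exists_exit_of_conn_rsd hL hr hs hd ht h
  · have ht'L : t' ∉ L := by rcases ht' with rfl | rfl | rfl <;> assumption
    exact ((notMem_L_of_conn_restrict_rsd hL ht'L hc) hx).elim
  · exact ⟨t', ht', htt', hc⟩

/-- **The first visit of `d`**: `d` is reached from `r` or `s` in `G` iff it is reached by a
segment of `G − F` or of the `F`-graph from `r` or `s`. -/
lemma d_mem_K2_iff_rsd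
    (hL : ∀ e x y, ends e = s(x, y) → x ∈ L → y ∈ L ∨ y = r ∨ y = s ∨ y = d)
    (hr : r ∉ L) (hs : s ∉ L) :
    d ∈ K2 ends r s ω ↔
      d ∈ K2 (fun e : {e // e ∉ within ends (L ∪ {r, s, d} : Set V)} => ends e.1) r s
        (fun e => ω e.1) ∨
      d ∈ K2 (fun e : {e // ¬ (e ∉ within ends (L ∪ {r, s, d} : Set V))} => ends e.1) r s
        (fun e => ω e.1) := by
  rw [mem_K2_iff, mem_K2_iff, mem_K2_iff]
  constructor
  · intro h
    -- the absorbing closure: `d` already reached by a segment, or a vertex `≠ d` reached by a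
    -- segment from `r` or `s`
    have key : ∀ t, (t = r ∨ t = s) → Conn ends ω t d →
        (Conn (fun e : {e // e ∉ within ends (L ∪ {r, s, d} : Set V)} => ends e.1) (fun e => ω e.1)
          r d ∨
        Conn (fun e : {e // e ∉ within ends (L ∪ {r, s, d} : Set V)} => ends e.1) (fun e => ω e.1)
          s d) ∨
        (Conn (fun e : {e // ¬ (e ∉ within ends (L ∪ {r, s, d} : Set V))} => ends e.1)
          (fun e => ω e.1) r d ∨
        Conn (fun e : {e // ¬ (e ∉ within ends (L ∪ {r, s, d} : Set V))} => ends e.1)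
          (fun e => ω e.1) s d) := by
      intro t ht hc
      have hmem : d ∈ {z | ((Conn (fun e : {e // e ∉ within ends (L ∪ {r, s, d} : Set V)} =>
            ends e.1) (fun e => ω e.1) r d ∨
          Conn (fun e : {e // e ∉ within ends (L ∪ {r, s, d} : Set V)} => ends e.1) (fun e => ω e.1)
            s d) ∨
          (Conn (fun e : {e // ¬ (e ∉ within ends (L ∪ {r, s, d} : Set V))} => ends e.1)
            (fun e => ω e.1) r d ∨
          Conn (fun e : {e // ¬ (e ∉ within ends (L ∪ {r, s, d} : Set V))} => ends e.1)
            (fun e => ω e.1) s d)) ∨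
          (z ≠ d ∧ ∃ t', (t' = r ∨ t' = s) ∧
            ((z ∉ L ∧ Conn (fun e : {e // e ∉ within ends (L ∪ {r, s, d} : Set V)} => ends e.1)
              (fun e => ω e.1) t' z) ∨
            (z ∈ L ∧ Conn (fun e : {e // ¬ (e ∉ within ends (L ∪ {r, s, d} : Set V))} => ends e.1)
              (fun e => ω e.1) t' z)))} := by
        refine mem_of_conn_of_closed ?_ ?_ hc
        · rintro a (ha | ⟨had, t', ht', ha⟩) b hab
          · exact Or.inl ha
          simp only [Set.mem_setOf_eq]
          obtain ⟨hne, e, he, hends⟩ := openGraph_adj.1 hab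
          have ht'L : t' ∉ L := by rcases ht' with rfl | rfl <;> assumption
          by_cases hP : e ∈ within ends (L ∪ {r, s, d} : Set V)
          · -- an `F`-edge: `a ∈ L` (then extend the `F`-segment) or `a ∈ {r, s}` (a new segment)
            have hadj : Conn (fun e : {e // ¬ (e ∉ within ends (L ∪ {r, s, d} : Set V))} =>
                ends e.1) (fun e => ω e.1) a b :=
              conn_of_openAdj ⟨⟨e, not_not.2 hP⟩, he, hends⟩
            have hFb : ∃ t'', (t'' = r ∨ t'' = s) ∧
                Conn (fun e : {e // ¬ (e ∉ within ends (L ∪ {r, s, d} : Set V))} => ends e.1)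
                  (fun e => ω e.1) t'' b := by
              rcases ha with ⟨haL, ha⟩ | ⟨haL, ha⟩
              · -- `a` off `L` on an `F`-edge: an exit other than `d`
                have haE := exit_of_mem_of_notMem (mem_of_mem_within hP hends).1 haL
                rcases haE with rfl | rfl | rfl
                · exact ⟨a, Or.inl rfl, hadj⟩
                · exact ⟨a, Or.inr rfl, hadj⟩
                · exact (had rfl).elim
              · exact ⟨t', ht', conn_trans ha hadj⟩
            obtain ⟨t'', ht'', hb⟩ := hFb
            by_cases hbd : b = d
            · subst hbd
              rcases ht'' with rfl | rfl
              · exact Or.inl (Or.inr (Or.inl hb))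
              · exact Or.inl (Or.inr (Or.inr hb))
            · by_cases hbL : b ∈ L
              · exact Or.inr ⟨hbd, t'', ht'', Or.inr ⟨hbL, hb⟩⟩
              · -- `b` off `L` at the end of an `F`-segment: an exit, `≠ d`, so `r` or `s`
                have hbE := exit_of_mem_of_notMem (mem_of_mem_within hP hends).2 hbL
                rcases hbE with rfl | rfl | rfl
                · exact Or.inr ⟨hbd, b, Or.inl rfl, Or.inl ⟨hbL, conn_refl _ _ _⟩⟩
                · exact Or.inr ⟨hbd, b, Or.inr rfl, Or.inl ⟨hbL, conn_refl _ _ _⟩⟩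
                · exact (hbd rfl).elim
          · -- an edge off `F`: `a ∉ L`, the restricted segment extends
            have hadj : Conn (fun e : {e // e ∉ within ends (L ∪ {r, s, d} : Set V)} => ends e.1)
                (fun e => ω e.1) a b :=
              conn_of_openAdj ⟨⟨e, hP⟩, he, hends⟩
            have haL : a ∉ L := (notMem_L_of_notMem_within_rsd hL hP hends).1
            have hbL : b ∉ L := (notMem_L_of_notMem_within_rsd hL hP hends).2
            have hRb : Conn (fun e : {e // e ∉ within ends (L ∪ {r, s, d} : Set V)} => ends e.1)
                (fun e => ω e.1) t' b := by
              rcases ha with ⟨_, ha⟩ | ⟨haL', _⟩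
              · exact conn_trans ha hadj
              · exact (haL haL').elim
            by_cases hbd : b = d
            · subst hbd
              rcases ht' with rfl | rfl
              · exact Or.inl (Or.inl (Or.inl hRb))
              · exact Or.inl (Or.inl (Or.inr hRb))
            · exact Or.inr ⟨hbd, t', ht', Or.inl ⟨hbL, hRb⟩⟩
        · -- the start `t ∈ {r, s}`
          simp only [Set.mem_setOf_eq]
          by_cases htd : t = d
          · subst htd
            rcases ht with rfl | rfl
            · exact Or.inl (Or.inl (Or.inl (conn_refl _ _ _)))
            · exact Or.inl (Or.inl (Or.inr (conn_refl _ _ _)))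
          · refine Or.inr ⟨htd, t, ht, Or.inl ⟨?_, conn_refl _ _ _⟩⟩
            rcases ht with rfl | rfl <;> assumption
      simp only [Set.mem_setOf_eq] at hmem
      rcases hmem with hmem | ⟨hne, _⟩
      · exact hmem
      · exact (hne rfl).elim
    rcases h with h | h
    · exact key r (Or.inl rfl) h
    · exact key s (Or.inr rfl) h
  · rintro ((h | h) | (h | h))
    · exact Or.inl (conn_of_conn_restrict h)
    · exact Or.inr (conn_of_conn_restrict h)
    · exact Or.inl (conn_of_conn_restrict h)
    · exact Or.inr (conn_of_conn_restrict h)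

end ClusterRSD

end NoPocket

end Summit.Ventures.PercRepro2
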